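import Literature.IUT.HodgeArakelov.EtaleThetaDataOfSettingCyclotomeKummerRelation
import Literature.AnabelianGeometry.EtaleTheta.Discharge.Sec1DeltaThetaTateTwist
import Literature.AnabelianGeometry.EtaleTheta.ThetaSettingOriginClauses

/-!
# [IUTchII] Prop 3.4 (i) / Cor 1.11 (b), binder `hgal` («HCYC-FROM-HGAL», file 3): the `μ_M`-valued Kummer cocycle
# `κ(g) = red_M φ[[g,B],B]` of `exists_cyclotomeExponent_kummer_relation` IS the Kummer cocycle of `q_X` — read off the
# [EtTh] §1 p. 13 Tate clause of `(Δ^tp_Y)^ell` through the commutator pairing `∧² Δ^ell_X → Δ_Θ`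

S. Mochizuki, *Inter-universal Teichmüller theory II*, kurims manuscript (Dec. 2020): Prop 3.4 (i) pp. 91–92, Cor 1.11 (b)
p. 49 [cite: Mochizuki2012, Prop 3.4 (i) p.92] — claim key DISPUTED (D-0012).  Refereed input ([EtTh] = S. Mochizuki, Publ.
RIMS **45** (2009)) §1 p. 12 («`1 → ∧² Δ^ell_X (≅ Ẑ(1)) → Δ^Θ_X → Δ^ell_X → 1`», «`(Ẑ(1) ≅) Δ_Θ`»), p. 13 («`(Δ^tp_Y)^ell ≅
Ẑ(1)`», «`1 → (Δ^tp_Y)^ell ⊗ ℤ/Nℤ → Gal(Y_N/Y) → Gal(K_N/K) → 1`, `K_N = K(ζ_N, q_X^{1/N})`») in abc-iut-w5-d051's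
print-faithful typing `ThetaSetting.IsTateOrigin` (abc-iut-L2-t6's `ThetaSettingOriginClauses`): per level `M` a generator
`y₁` of `(Δ^tp_Y)^ell/M` (a), the Tate twist (b), the Kummer class of `q_X` (c).  abc-iut cell, layer L6, WAVE-5 seat
abc-iut-w5-d169 (gen 5; holder lineage of node IUTchII:Prop3.4(i)); GAP-LEDGER G-w5d169-3 / G-w5d145-2, D-row D-G-w5d169-3
of 2026-08-26T11:4xZ («(HCYC) ⟸ (HGAL)» route; this is its part 2a).  Tools BY NAME: abc-iut-w5-d187's
`Discharge/Sec1DeltaThetaTateTwist` (class-two bilinearity of `y ↦ θ[z,y]`, `exists_toTheta_commutator_eq_pow_mul_pow`,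
`exists_eq_pow_mul_commutator_pow` — Heisenberg surjectivity under `IsEtThOrigin` + the closedness binder `hYcl`
(GAP G-w4d021-2, class R), `galMuN_eq_pow_of_apply_eq_pow`), abc-iut-L2's `dtpYTheta_comm`.

PROOF-ONLY (no definition, no `Prop`-valued fact, nothing restated).
* `kummer_cocycle_of_tate` — at a level `M`, from the Tate-clause DATA `(y₁, z, ζ, r)` with (a) cyclicity, (b) twist, (c)
  Kummer clause: there are `ξ, w ∈ μ_M`, `ξ` PRIMITIVE, with `red_M φ[[g,B],B] = ξ^{l m} · (aug(g)·w)·w⁻¹` for every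
  `g ∈ Π^tp_{X̲̲}` and `m` with `aug(g) r = ζ^m r`.  Computation: `B = z^l y_B` (`y_B ∈ Δ^tp_Y`), `θ[[g,B], B] = (θ[z,[g,B]]^l)⁻¹`,
  `θ[z,[g,B]] = θ[z,[g,z]]^l · θ[z, g y_B g⁻¹] · θ[z,y_B]⁻¹`, then (c) and (b); primitivity of `ξ = (red_M(c₀^l))⁻¹`,
  `c₀ = θ[z,y₁]`, from `Δ_Θ = c₀^ℕ · Δ_Θ^M` and the surjectivity of `red_M ∘ (·)^l : Δ_Θ ↠ μ_M`.
* `kummer_cocycle_of_isTateOrigin` — the same from `hT : D.IsTateOrigin` (class-R origin clause, never asserted).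
Consumer: file 4 (`EtaleThetaDataOfSettingHcycOfHgal.lean`) combines this with file 2's `q`-Kummer relation and the classical
Kummer–valuation rigidity (`Literature.NumberTheory.GaloisRepresentations.PadicAlgCl.kummer_valuation_rigidity`).
Nothing here asserts anything of [IUTchII] or [EtTh]; no side taken on [IUTchIII] Cor 3.12; typed ≠ proved for the binders.
-/

noncomputable section

open Topology

namespace Literature.IUT.HodgeArakelov

namespace EtaleThetaDataOfSetting

open Literature.AnabelianGeometry.EtaleTheta Literature.AnabelianGeometry.SemiGraphs

variable {p : ℕ} [Fact p.Prime] {D : Literature.AnabelianGeometry.EtaleTheta.ThetaSetting p}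
  {E : D.EtaleThetaData} {l : ℕ} (C : E.DoubleUnderline l)

/-- `toZ B = l` for `B ∈ Π^tp_{X̲̲}` with `toLZ B = 1`. [cite: MochizukiEtTh2009, Def 2.13 (i) p.47] -/
theorem toZ_eq_of_toLZ {B : Pi C} (hBY : C.toLZ B = Multiplicative.ofAdd 1) :
    D.toZ (B : D.PiTemp) = Multiplicative.ofAdd (l : ℤ) := by
  have h := C.toZ_eq B
  have h1 : C.zExp B = 1 := by
    have : Multiplicative.ofAdd (C.zExp B) = Multiplicative.ofAdd 1 := hBY
    exact Multiplicative.ofAdd.injective this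
  rw [h1, mul_one] at h
  rw [← h, ofAdd_toAdd]

/-- **THE KUMMER COCYCLE OF `B` IS THE KUMMER COCYCLE OF `q_X`** (part 2a of «(HCYC) ⟸ (HGAL)»).  At a level `M`, let the
[EtTh] §1 p. 13 Tate clause of `(Δ^tp_Y)^ell` be given in abc-iut-w5-d051's print-faithful form (the data of
`ThetaSetting.IsTateOrigin.tate M`: a generator `y₁` of `(Δ^tp_Y)^ell/M` (cyclicity `hcyc`), a lift `z ∈ Δ^tp_X` of `1 ∈ Z`,
a primitive `M`-th root `ζ`, an `M`-th root `r` of `q_X`, the Tate twist `htw` and the Kummer clause `hkum`), together with the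
freeness guard `IsEtThOrigin` and the closedness binder `hYcl` (Heisenberg surjectivity of `y ↦ θ[z,y]`, abc-iut-L2/L5).  Then
for the identification `red_M : l·Δ_Θ ↠ μ_M` and a geometric `Z`-generator `B ∈ Δ^tp_{X̲̲}` there are `ξ, w ∈ μ_M`, `ξ` a
PRIMITIVE `M`-th root of unity, such that for every `g ∈ Π^tp_{X̲̲}` and `m` with `aug(g) r = ζ^m r`:
`red_M φ[[g,B],B] = ξ^{l m} · (aug(g)·w) · w⁻¹` — the cocycle `κ` of `exists_cyclotomeExponent_kummer_relation` is, up to the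
unit `ξ ↔ ζ` and a coboundary, the `l`-th power of the Kummer cocycle `σ ↦ σ(r)/r` of `q_X`.  Computation: `B = z^l y_B`,
`θ[B, n] = θ[z, n]^l`, `θ[z, [g,B]] = θ[z,[g,z]]^l · θ[z, g y_B g⁻¹] · θ[z, y_B]⁻¹`, then clauses (c) and (b) through
abc-iut-w5-d187's `exists_toTheta_commutator_eq_pow_mul_pow`; primitivity of `ξ` from `Δ_Θ = c₀^ℕ · Δ_Θ^M`
(`exists_eq_pow_mul_commutator_pow`). [cite: MochizukiEtTh2009, §1 p.13] -/
theorem kummer_cocycle_of_tate (hO : D.IsEtThOrigin)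
    (hYcl : (D.DtpY.map D.toHat.toMonoidHom).topologicalClosure ≤
      D.DtpY.map D.toHat.toMonoidHom ⊔ (⁅⁅D.DeltaHat, D.DeltaHat⁆, D.DeltaHat⁆).topologicalClosure)
    {M : ℕ+} (ν : D.CyclotomeMod l M) {B : Pi C} (hB : aug C B = 1) (hBY : C.toLZ B = Multiplicative.ofAdd 1)
    {y₁ z : D.PiTemp} {ζ r : PadicAlgCl p} (hy₁ : y₁ ∈ D.DtpY) (hz : z ∈ D.DeltaTemp)
    (hzZ : D.toZ z = Multiplicative.ofAdd 1) (hζ : IsPrimitiveRoot ζ (M : ℕ))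
    (hcyc : ∀ y ∈ D.DtpY, ∃ k : ℕ, Thm16Sub.toEll D y * (Thm16Sub.toEll D y₁ ^ k)⁻¹ ∈ Thm16Sub.ellPowersY D M)
    (htw : ∀ (g : D.PiTemp) (k : ℕ), D.aug g ζ = ζ ^ k → ∀ y ∈ D.DtpY,
      Thm16Sub.toEll D (g * y * g⁻¹) * (Thm16Sub.toEll D y ^ k)⁻¹ ∈ Thm16Sub.ellPowersY D M)
    (hkum : ∀ (g : D.PiTemp) (m : ℕ), D.aug g r = ζ ^ m * r →
      Thm16Sub.toEll D (g * z * g⁻¹ * z⁻¹) * (Thm16Sub.toEll D y₁ ^ m)⁻¹ ∈ Thm16Sub.ellPowersY D M) :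
    ∃ ξ w : MuN p M, IsPrimitiveRoot ξ (M : ℕ) ∧
      ∀ (g : Pi C) (m : ℕ), D.aug (g : D.PiTemp) r = ζ ^ m * r →
        ν.red ⟨phi C ((g * B * g⁻¹ * B⁻¹) * B * (g * B * g⁻¹ * B⁻¹)⁻¹ * B⁻¹),
            phi_commutator_mem_lDeltaTheta C (aug_kummer_eq_one C hB g) hB⟩ =
          ξ ^ (l * m) * (galMuN p M (aug C g) w * w⁻¹) := by
  classical
  haveI : D.GtpY.Normal := inferInstanceAs D.toZ.ker.Normal
  haveI : D.DeltaTemp.Normal := inferInstanceAs D.aug.toMonoidHom.ker.Normal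
  haveI : D.DtpY.Normal := Subgroup.normal_inf_normal _ _
  have hBΔ : (B : D.PiTemp) ∈ D.DeltaTemp := mem_deltaTemp_of_aug_eq_one C hB
  have hBZ : D.toZ (B : D.PiTemp) = Multiplicative.ofAdd (l : ℤ) := toZ_eq_of_toLZ C hBY
  -- `B = z^l · y_B` with `y_B ∈ Δ^tp_Y`
  set yB : D.PiTemp := (z ^ l)⁻¹ * (B : D.PiTemp) with hyB
  have hyBY : yB ∈ D.DtpY := by
    have hzl : (z ^ l)⁻¹ ∈ D.DeltaTemp := D.DeltaTemp.inv_mem (D.DeltaTemp.pow_mem hz l)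
    refine ⟨?_, D.DeltaTemp.mul_mem hzl hBΔ⟩
    change yB ∈ D.toZ.ker
    rw [MonoidHom.mem_ker, hyB, map_mul, map_inv, map_pow, hzZ, hBZ, ← ofAdd_nsmul, nsmul_eq_mul, mul_one,
      inv_mul_cancel]
  have hBeq : (B : D.PiTemp) = z ^ l * yB := by rw [hyB]; group
  -- the `l`-th power map `Δ_Θ → l·Δ_Θ` and `red' := red ∘ (·)^l`
  let lpow : D.DeltaTheta →* D.lDeltaTheta l :=
    { toFun := fun s => ⟨(s : D.GtpTheta) ^ l, ⟨s, s.2, rfl⟩⟩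
      map_one' := Subtype.ext (by simp)
      map_mul' := fun a b => Subtype.ext (by
        change ((a : D.GtpTheta) * b) ^ l = (a : D.GtpTheta) ^ l * (b : D.GtpTheta) ^ l
        exact (Commute.mul_pow (D.ker_thetaToEll_comm a a.2 b b.2) l)) }
  have hlpow : ∀ s : D.DeltaTheta, ((lpow s : D.lDeltaTheta l) : D.GtpTheta) = (s : D.GtpTheta) ^ l := fun s => rfl
  set c₀ : D.DeltaTheta := ⟨D.toTheta (z * y₁ * z⁻¹ * y₁⁻¹), D.toTheta_commutator_mem_deltaTheta hz hy₁.2⟩ with hc₀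
  set θB : D.DeltaTheta := ⟨D.toTheta (z * yB * z⁻¹ * yB⁻¹), D.toTheta_commutator_mem_deltaTheta hz hyBY.2⟩ with hθB
  set ξ₀ : MuN p M := ν.red (lpow c₀) with hξ₀
  set w₀ : MuN p M := ν.red (lpow θB) with hw₀
  -- `x^M = 1` in `μ_M`
  have hMpow : ∀ x : MuN p M, x ^ ((M : ℕ+) : ℕ) = 1 := fun x => by
    have h := pow_card_eq_one (G := MuN p M) (x := x); rwa [card_MuN] at h
  have hredM : ∀ e : D.DeltaTheta, ν.red (lpow e) ^ ((M : ℕ+) : ℕ) = 1 := fun e => hMpow _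
  -- primitivity of `ξ₀`: `Δ_Θ = c₀^ℕ · Δ_Θ^M` and `red ∘ (·)^l` is onto `μ_M`
  have hgen : ∀ x : MuN p M, x ∈ Subgroup.zpowers ξ₀ := by
    intro x
    obtain ⟨s', hs'⟩ := ν.red_surjective x
    obtain ⟨s, hs, hss'⟩ := s'.2
    obtain ⟨e, he, j, hej⟩ := D.exists_eq_pow_mul_commutator_pow hO hYcl hz hzZ hy₁ hcyc hs
    have hs'eq : s' = lpow (⟨e, he⟩ ^ ((M : ℕ+) : ℕ) * c₀ ^ j) := by
      apply Subtype.ext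
      rw [hlpow, ← hss', hej]; rfl
    rw [← hs', hs'eq]
    simp only [map_mul, map_pow, hredM, one_mul]
    exact Subgroup.mem_zpowers_iff.2 ⟨j, zpow_natCast ξ₀ j⟩
  have hξ₀prim : IsPrimitiveRoot ξ₀ ((M : ℕ+) : ℕ) := by
    rw [IsPrimitiveRoot.iff_orderOf, orderOf_eq_card_of_forall_mem_zpowers hgen, Nat.card_eq_fintype_card, card_MuN]
  refine ⟨ξ₀⁻¹, w₀⁻¹, hξ₀prim.inv, fun g m hm => ?_⟩
  -- notation for the computation
  set gh : D.PiTemp := (g : D.PiTemp) with hgh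
  have hn : gh * (B : D.PiTemp) * gh⁻¹ * (B : D.PiTemp)⁻¹ ∈ D.DtpY := D.conj_mul_inv_mem_dtpY hBΔ gh
  have hkz : gh * z * gh⁻¹ * z⁻¹ ∈ D.DtpY := D.conj_mul_inv_mem_dtpY hz gh
  have hgy : gh * yB * gh⁻¹ ∈ D.DtpY := (inferInstance : D.DtpY.Normal).conj_mem _ hyBY gh
  set n : D.PiTemp := gh * (B : D.PiTemp) * gh⁻¹ * (B : D.PiTemp)⁻¹ with hndef
  -- (A) `θ[n, B] = (θ[z, n]^l)⁻¹`
  have hA : D.toTheta (n * (B : D.PiTemp) * n⁻¹ * (B : D.PiTemp)⁻¹) =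
      (D.toTheta (z * n * z⁻¹ * n⁻¹) ^ l)⁻¹ := by
    have e1 : n * (B : D.PiTemp) * n⁻¹ * (B : D.PiTemp)⁻¹ = ((B : D.PiTemp) * n * (B : D.PiTemp)⁻¹ * n⁻¹)⁻¹ := by
      group
    have e2 : (B : D.PiTemp) * n * (B : D.PiTemp)⁻¹ * n⁻¹ =
        (z ^ l * (yB * n * yB⁻¹ * n⁻¹) * (z ^ l)⁻¹) * (z ^ l * n * (z ^ l)⁻¹ * n⁻¹) := by
      rw [hBeq]; group
    have eX : D.toTheta (z ^ l * (yB * n * yB⁻¹ * n⁻¹) * (z ^ l)⁻¹) = 1 := by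
      have hyn : D.toTheta yB * D.toTheta n * (D.toTheta yB)⁻¹ * (D.toTheta n)⁻¹ = 1 :=
        D.commutator_eq_one_of_mem_dtpYTheta hO (Subgroup.mem_map_of_mem _ hyBY) (Subgroup.mem_map_of_mem _ hn)
      simp only [map_mul, map_inv, hyn, mul_one, mul_inv_cancel]
    have e3 : z ^ l * n * (z ^ l)⁻¹ * n⁻¹ = (n * z ^ l * n⁻¹ * (z ^ l)⁻¹)⁻¹ := by group
    have e4 : n * z * n⁻¹ * z⁻¹ = (z * n * z⁻¹ * n⁻¹)⁻¹ := by group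
    rw [e1, map_inv, e2, map_mul, eX, one_mul, e3, map_inv, D.toTheta_commutator_pow hn.2 hz l, e4, map_inv, inv_pow,
      inv_inv]
  -- (B) `θ[z, n] = θ[z, [g,z]]^l · θ[z, g y_B g⁻¹] · θ[z, y_B]⁻¹`
  have hgz : gh * z * gh⁻¹ ∈ D.DeltaTemp := (inferInstance : D.DeltaTemp.Normal).conj_mem _ hz gh
  have hB' : D.toTheta (z * n * z⁻¹ * n⁻¹) =
      D.toTheta (z * (gh * z * gh⁻¹ * z⁻¹) * z⁻¹ * (gh * z * gh⁻¹ * z⁻¹)⁻¹) ^ l *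
        D.toTheta (z * (gh * yB * gh⁻¹) * z⁻¹ * (gh * yB * gh⁻¹)⁻¹) *
          (D.toTheta (z * yB * z⁻¹ * yB⁻¹))⁻¹ := by
    have hX : (gh * z * gh⁻¹) ^ l * (gh * yB * gh⁻¹) * yB⁻¹ ∈ D.DeltaTemp :=
      mul_mem (mul_mem (pow_mem hgz l) hgy.2) (inv_mem hyBY.2)
    have en : n = ((gh * z * gh⁻¹) ^ l * (gh * yB * gh⁻¹) * yB⁻¹) * (z ^ l)⁻¹ := by
      rw [hndef, hBeq, conj_pow]; group
    have ezl : D.toTheta (z * (z ^ l)⁻¹ * z⁻¹ * (z ^ l)⁻¹⁻¹) = 1 := by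
      rw [show z * (z ^ l)⁻¹ * z⁻¹ * (z ^ l)⁻¹⁻¹ = 1 by group, map_one]
    have ezz : D.toTheta (z * z * z⁻¹ * z⁻¹) = 1 := by
      rw [show z * z * z⁻¹ * z⁻¹ = 1 by group, map_one]
    have ekz : gh * z * gh⁻¹ = (gh * z * gh⁻¹ * z⁻¹) * z := by group
    rw [en, D.toTheta_commutator_mul hz hX (inv_mem (pow_mem hz l)), ezl, mul_one,
      D.toTheta_commutator_mul hz (mul_mem (pow_mem hgz l) hgy.2) (inv_mem hyBY.2),
      D.toTheta_commutator_mul hz (pow_mem hgz l) hgy.2, D.toTheta_commutator_pow hz hgz l,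
      D.toTheta_commutator_inv hz hyBY.2]
    conv_lhs => rw [ekz, D.toTheta_commutator_mul hz hkz.2 hz, ezz, mul_one]
  -- (C) the clauses: `θ[z,[g,z]] = e₁^M c₀^m` (Kummer clause), `θ[z, g y_B g⁻¹] = e₂^M θ_B^k` (Tate twist)
  obtain ⟨k, hk⟩ := ThetaSetting.exists_apply_eq_pow hζ (D.aug gh)
  obtain ⟨e₁, he₁, h1⟩ := D.exists_toTheta_commutator_eq_pow_mul_pow hz hy₁ hkz (hkum gh m hm)
  obtain ⟨e₂, he₂, h2⟩ := D.exists_toTheta_commutator_eq_pow_mul_pow hz hyBY hgy (htw gh k hk yB hyBY)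
  -- (D) assemble in the commutative group `Δ_Θ`, push through `red ∘ (·)^l`
  set Θn : D.DeltaTheta := ⟨D.toTheta (z * n * z⁻¹ * n⁻¹), D.toTheta_commutator_mem_deltaTheta hz hn.2⟩ with hΘn
  have hΘn_eq : Θn = ((⟨e₁, he₁⟩ : D.DeltaTheta) ^ ((M : ℕ+) : ℕ) * c₀ ^ m) ^ l *
      ((⟨e₂, he₂⟩ : D.DeltaTheta) ^ ((M : ℕ+) : ℕ) * θB ^ k) * θB⁻¹ := by
    apply Subtype.ext
    change D.toTheta (z * n * z⁻¹ * n⁻¹) = _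
    rw [hB', h1, h2]
    rfl
  have hκΘ : (⟨phi C ((g * B * g⁻¹ * B⁻¹) * B * (g * B * g⁻¹ * B⁻¹)⁻¹ * B⁻¹),
      phi_commutator_mem_lDeltaTheta C (aug_kummer_eq_one C hB g) hB⟩ : D.lDeltaTheta l) = (lpow Θn)⁻¹ := by
    apply Subtype.ext
    change D.toTheta (n * (B : D.PiTemp) * n⁻¹ * (B : D.PiTemp)⁻¹) = ((Θn : D.GtpTheta) ^ l)⁻¹
    rw [hA]
  have hw₀k : galMuN p M (aug C g) w₀ = w₀ ^ k := ThetaSetting.galMuN_eq_pow_of_apply_eq_pow hζ hk w₀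
  rw [hκΘ, hΘn_eq]
  simp only [map_mul, map_pow, map_inv]
  rw [hredM, hredM, one_mul, one_mul, ← hξ₀, ← hw₀, hw₀k, ← pow_mul, mul_comm m l, inv_pow, mul_inv_rev, mul_inv_rev,
    inv_inv, mul_comm w₀, mul_assoc, mul_left_comm ((w₀ ^ k)⁻¹)]

/-- **The Kummer cocycle of `B` from the origin clause `IsTateOrigin`** (abc-iut-w5-d051 / abc-iut-L2-t6, class R): at every
level `M`, primitive roots `ζ, ξ`, an `M`-th root `r` of `q_X` and `w ∈ μ_M` with `red_M φ[[g,B],B] = ξ^{l m} · (aug(g)·w)·w⁻¹`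
whenever `aug(g) r = ζ^m r`. [cite: MochizukiEtTh2009, §1 p.13] -/
theorem kummer_cocycle_of_isTateOrigin (hO : D.IsEtThOrigin)
    (hYcl : (D.DtpY.map D.toHat.toMonoidHom).topologicalClosure ≤
      D.DtpY.map D.toHat.toMonoidHom ⊔ (⁅⁅D.DeltaHat, D.DeltaHat⁆, D.DeltaHat⁆).topologicalClosure)
    (hT : D.IsTateOrigin) (M : ℕ+) (ν : D.CyclotomeMod l M) {B : Pi C} (hB : aug C B = 1)
    (hBY : C.toLZ B = Multiplicative.ofAdd 1) :
    ∃ (ζ r : PadicAlgCl p) (ξ w : MuN p M), IsPrimitiveRoot ζ (M : ℕ) ∧ r ^ (M : ℕ) = D.qX ∧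
      IsPrimitiveRoot ξ (M : ℕ) ∧
      ∀ (g : Pi C) (m : ℕ), D.aug (g : D.PiTemp) r = ζ ^ m * r →
        ν.red ⟨phi C ((g * B * g⁻¹ * B⁻¹) * B * (g * B * g⁻¹ * B⁻¹)⁻¹ * B⁻¹),
            phi_commutator_mem_lDeltaTheta C (aug_kummer_eq_one C hB g) hB⟩ =
          ξ ^ (l * m) * (galMuN p M (aug C g) w * w⁻¹) := by
  obtain ⟨y₁, z, ζ, r, hy₁, hz, hzZ, hζ, hr, hcyc, -, htw, hkum⟩ := hT.tate M
  obtain ⟨ξ, w, hξ, h⟩ := kummer_cocycle_of_tate C hO hYcl ν hB hBY hy₁ hz hzZ hζ hcyc htw hkum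
  exact ⟨ζ, r, ξ, w, hζ, hr, hξ, h⟩

end EtaleThetaDataOfSetting

end Literature.IUT.HodgeArakelov

end
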